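import Literature.NumberTheory.LFunctions.ClassGroupLFunctionConvexity
import Literature.NumberTheory.LFunctions.ClassGroupCharacterTwist
import Literature.NumberTheory.LFunctions.DedekindZetaPartialFraction
import Literature.NumberTheory.LFunctions.TwistedZeroFreeRegion
import HarnessLib

/-!
# Zeros of the `L`-functions of class group characters in discs: Jensen's inequality, uniformly
# in the number field (Thorner–Zaman Lemma 2.5 / Lagarias–Odlyzko Lemma 5.4 for `L(s, χ, H_K/K)`)

Topic `Literature/NumberTheory/LFunctions` (namespace `Literature.NumberTheory.LFunctions.NumberField`),
continuing `ClassGroupLFunctionConvexity.lean` (the entire `Z₁_a(s) = (s − 1) Σ_C a(C) ζ(C, s)` and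
its uniform convexity bound) and following `DedekindZetaLogDerivGRH.lean` (the case `ζ_K`) line by
line.  Everything here is PROVED (theorems only).

* `exp_neg_finrank_div_le_norm_classGroupLFunction` — **`|L(s, χ)| ≥ e^{−n_K/(σ − 1)}`** for
  `σ > 1`, uniformly in `K` and `χ` (`L(μ_K ν_χ, s) · L(s, χ) = 1` and
  `|L(μ_K ν_χ, s)| ≤ ζ_K(σ) ≤ e^{n_K/(σ−1)}`, the tree's `norm_dedekindZeta_le_exp_finrank_div`);
* `norm_classTwistedZeta₁_le_of_mem_closedBall` — on the discs `|z − (2 + it)| ≤ 2`,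
  `|Z₁_a(z)| ≤ |d_K| e^{2n_K} (|t| + 7)^{n_K + 1}` (`|a| ≤ 1`);
* `exp_neg_finrank_le_norm_classTwistedZeta₁_two_add` — `|Z₁_χ(2 + it)| ≥ e^{−n_K}`;
* `finsum_divisor_classTwistedZeta₁_le` — **Jensen**: for `0 < r < 2` the number of zeros of
  `Z₁_χ = (s − 1) L(s, χ)` in `|s − (2 + it)| ≤ r`, with multiplicity, is at most
  `M_K(t)/log(2/r)`, `M_K(t) = log|d_K| + 3n_K + (n_K + 1) log(|t| + 7)` (the tree's `discBound`) —
  [ThornerZaman2019, Lemma 2.5] ("`#{ρ : |γ − t| ≤ 1} ≪ log(D_K N𝔣_χ) + n_K log(|t| + 3)`", quoted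
  from [LO, Lemma 5.4]) for `𝔣_χ = 1`, in disc form with absolute constants;
  `sum_divisor_classTwistedZeta₁_le` — `≤ 8 M_K(t)` zeros in the disc of radius `7/4`;
* `norm_logDeriv_classTwistedZeta₁_sub_sum_le` — **the local partial fraction** ([LO, Lemma 5.6],
  disc form, uniformly in `K` and `χ`): for `|s − (2 + it)| ≤ 7/4`, `Z₁_χ(s) ≠ 0`,
  `|Z₁_χ'/Z₁_χ(s) − Σ_ρ m(ρ)/(s − ρ)| ≤ 77760 M_K(t)` over the zeros in `|ρ − (2 + it)| ≤ 31/16`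
  (the tree's `DedekindZetaPartialFraction.lean` for `ζ_K`, followed line by line).

## References

* J. Thorner, A. Zaman, *A unified and improved Chebotarev density theorem*, ANT 13 (2019),
  Lemma 2.5. [ThornerZaman2019]
* J. C. Lagarias, A. M. Odlyzko, *Effective versions of the Chebotarev density theorem* (1977),
  Lemma 5.4. [LagariasOdlyzko1977]
-/

noncomputable section

open scoped NumberField nonZeroDivisors
open Complex Filter Topology Set Metric MeromorphicOn NumberField

namespace Literature.NumberTheory.LFunctions.NumberField

variable {K : Type*} [Field K] [NumberField K]

/-! ### The uniform lower bound `|L(s, χ)| ≥ e^{−n_K/(σ−1)}` on `σ > 1` -/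

variable (K) in
/-- `|L(μ_K ν_χ, s)| ≤ |ζ_K(σ)|` for `σ = Re s > 1` (`|μ_K ν_χ| ≤ 1` termwise, majorant
`#{𝔞 : N𝔞 = n}`). [folklore] -/
theorem norm_LSeries_twistMoebius_le (χ : ClassGroup (𝓞 K) →* ℂˣ) {s : ℂ} (hs : 1 < s.re) :
    ‖LSeries (twistMoebius K (classGroupCharIdealHom χ)) s‖ ≤ ‖dedekindZeta K (s.re : ℂ)‖ := by
  have hf : ∀ n, ‖twistMoebius K (classGroupCharIdealHom χ) n‖ ≤ (idealNormCount K n : ℝ) :=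
    fun n ↦ norm_twistMoebius_le (norm_classGroupCharIdealHom_le χ) n
  have hsum : ∀ w : ℂ, 1 < w.re → LSeriesSummable (fun n ↦ ((idealNormCount K n : ℝ) : ℂ)) w := by
    intro w hw
    have h := LSeriesSummable_idealNormCount K hw
    simpa only [Complex.ofReal_natCast] using h
  have h := TwistedZFR.norm_LSeries_le_of_norm_le hf hsum hs le_rfl
  refine h.trans ?_
  have heq : LSeries (fun n ↦ ((idealNormCount K n : ℝ) : ℂ)) (s.re : ℂ) = dedekindZeta K (s.re : ℂ) := by
    rw [Literature.NumberTheory.LFunctions.dedekindZeta_eq_LSeries]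
    simp only [Complex.ofReal_natCast]
  rw [heq]
  exact Complex.re_le_norm _

variable (K) in
/-- **`|L(s, χ)| ≥ e^{−n_K/(σ − 1)}` for `σ > 1`**, uniformly in the number field and the class
group character: `L(μ_K ν_χ, s) L(s, χ) = 1` (the tree's `LSeries_twistMoebius_mul_twistCount`) and
`|L(μ_K ν_χ, s)| ≤ ζ_K(σ) ≤ e^{n_K/(σ−1)}` (`norm_dedekindZeta_le_exp_finrank_div`). [folklore] -/
theorem exp_neg_finrank_div_le_norm_classGroupLFunction (χ : ClassGroup (𝓞 K) →* ℂˣ) {s : ℂ}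
    (hs : 1 < s.re) :
    Real.exp (-(Module.finrank ℚ K / (s.re - 1))) ≤ ‖classGroupLFunction K χ s‖ := by
  have hν := norm_classGroupCharIdealHom_le χ
  have h1 := LSeries_twistMoebius_mul_twistCount hν hs
  rw [LSeries_twistCount_classGroupCharIdealHom K χ hs] at h1
  have hM := norm_LSeries_twistMoebius_le K χ hs
  have hζ : ‖dedekindZeta K (s.re : ℂ)‖ ≤ Real.exp (Module.finrank ℚ K / (s.re - 1)) := by
    have h := NumberField.norm_dedekindZeta_le_exp_finrank_div K (s := (s.re : ℂ)) (by simpa using hs)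
    simpa using h
  have hn := congrArg norm h1
  rw [norm_mul, norm_one] at hn
  have hE : 0 < Real.exp (Module.finrank ℚ K / (s.re - 1)) := Real.exp_pos _
  have hL0 : 0 < ‖classGroupLFunction K χ s‖ := by
    rcases (norm_nonneg (classGroupLFunction K χ s)).lt_or_eq with h | h
    · exact h
    · rw [← h, mul_zero] at hn; exact absurd hn zero_ne_one
  rw [Real.exp_neg, inv_le_iff_one_le_mul₀ hE]
  calc (1 : ℝ) = ‖LSeries (twistMoebius K (classGroupCharIdealHom χ)) s‖ * ‖classGroupLFunction K χ s‖ :=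
        hn.symm
    _ ≤ Real.exp (Module.finrank ℚ K / (s.re - 1)) * ‖classGroupLFunction K χ s‖ :=
        mul_le_mul_of_nonneg_right (hM.trans hζ) (norm_nonneg _)
    _ = ‖classGroupLFunction K χ s‖ * Real.exp (Module.finrank ℚ K / (s.re - 1)) := mul_comm _ _

/-- **`|Z₁_χ(2 + it)| ≥ e^{−n_K}`**: `|1 + it| ≥ 1` and `|L(2 + it, χ)| ≥ e^{−n_K}`. [folklore] -/
theorem exp_neg_finrank_le_norm_classTwistedZeta₁_two_add (χ : ClassGroup (𝓞 K) →* ℂˣ) (t : ℝ) :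
    Real.exp (-(Module.finrank ℚ K : ℝ)) ≤ ‖classTwistedZeta₁ K (fun C ↦ (χ C : ℂ)) (2 + t * I)‖ := by
  have hre : (2 + t * I : ℂ).re = 2 := by simp
  have h2 : 1 < (2 + t * I : ℂ).re := by rw [hre]; norm_num
  have hne : (2 + t * I : ℂ) ≠ 1 := fun h ↦ by
    have := congrArg Complex.re h; simp at this
  rw [← sub_one_mul_classGroupLFunction χ hne, norm_mul]
  have h1 : 1 ≤ ‖(2 + t * I : ℂ) - 1‖ := by
    have : ((2 + t * I : ℂ) - 1).re = 1 := by simp; norm_num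
    calc (1 : ℝ) = |((2 + t * I : ℂ) - 1).re| := by rw [this, abs_one]
      _ ≤ ‖(2 + t * I : ℂ) - 1‖ := abs_re_le_norm _
  have hL := exp_neg_finrank_div_le_norm_classGroupLFunction K χ h2
  rw [hre, show (2 : ℝ) - 1 = 1 by norm_num, div_one] at hL
  calc Real.exp (-(Module.finrank ℚ K : ℝ)) = 1 * Real.exp (-(Module.finrank ℚ K : ℝ)) :=
        (one_mul _).symm
    _ ≤ ‖(2 + t * I : ℂ) - 1‖ * ‖classGroupLFunction K χ (2 + ↑t * I)‖ :=
        mul_le_mul h1 hL (Real.exp_pos _).le (norm_nonneg _)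

/-! ### The disc bound and Jensen's inequality -/

/-- **The convexity bound on the discs `|z − (2 + it)| ≤ 2`**:
`|Z₁_a(z)| ≤ |d_K| e^{2n_K} (|t| + 7)^{n_K + 1}` for `|a| ≤ 1`. [cite: Rademacher1959, Thm. 4] -/
theorem norm_classTwistedZeta₁_le_of_mem_closedBall {a : ClassGroup (𝓞 K) → ℂ}
    (ha : ∀ C, ‖a C‖ ≤ 1) (t : ℝ) {z : ℂ} (hz : z ∈ closedBall (2 + t * I) 2) :
    ‖classTwistedZeta₁ K a z‖ ≤ ((discr K).natAbs : ℝ) * Real.exp (2 * Module.finrank ℚ K) *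
      (|t| + 7) ^ (Module.finrank ℚ K + 1) := by
  rw [mem_closedBall, dist_eq_norm] at hz
  have hre : |z.re - 2| ≤ 2 := by
    have := abs_re_le_norm (z - (2 + t * I))
    simp at this
    linarith
  have hz₁ : -1 / 2 ≤ z.re := by have := (abs_le.mp hre).1; linarith
  refine (norm_classTwistedZeta₁_le ha hz₁).trans ?_
  have hN : ‖z + 5 / 2‖ ≤ |t| + 7 := by
    calc ‖z + 5 / 2‖ = ‖(z - (2 + t * I)) + (9 / 2 + t * I)‖ := by ring_nf
      _ ≤ ‖z - (2 + t * I)‖ + ‖(9 / 2 : ℂ) + t * I‖ := norm_add_le _ _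
      _ ≤ 2 + (9 / 2 + |t|) := by
          gcongr
          calc ‖(9 / 2 : ℂ) + t * I‖ ≤ |((9 / 2 : ℂ) + t * I).re| + |((9 / 2 : ℂ) + t * I).im| :=
                Complex.norm_le_abs_re_add_abs_im _
            _ = 9 / 2 + |t| := by simp; norm_num
      _ ≤ |t| + 7 := by linarith
  gcongr

/-- The Jensen quotient for `Z₁_χ` is dominated by the tree's `M_K(t) = discBound K t`:
`log( |d_K| e^{2n_K} (|t|+7)^{n_K+1} / |Z₁_χ(2+it)| ) ≤ M_K(t)`. [folklore] -/
theorem log_discSup_div_norm_classTwistedZeta₁_le (χ : ClassGroup (𝓞 K) →* ℂˣ) (t : ℝ) :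
    Real.log (((discr K).natAbs : ℝ) * Real.exp (2 * Module.finrank ℚ K) *
        (|t| + 7) ^ (Module.finrank ℚ K + 1) / ‖classTwistedZeta₁ K (fun C ↦ (χ C : ℂ)) (2 + t * I)‖) ≤
      discBound K t := by
  set n : ℕ := Module.finrank ℚ K with hn
  have hd : (0 : ℝ) < ((discr K).natAbs : ℝ) := by exact_mod_cast Int.natAbs_pos.mpr (discr_ne_zero K)
  have ht : (0 : ℝ) < |t| + 7 := by linarith [abs_nonneg t]
  have hf0 : 0 < Real.exp (-(n : ℝ)) := Real.exp_pos _
  have hf : Real.exp (-(n : ℝ)) ≤ ‖classTwistedZeta₁ K (fun C ↦ (χ C : ℂ)) (2 + t * I)‖ :=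
    exp_neg_finrank_le_norm_classTwistedZeta₁_two_add χ t
  have hfpos : 0 < ‖classTwistedZeta₁ K (fun C ↦ (χ C : ℂ)) (2 + t * I)‖ := hf0.trans_le hf
  rw [Real.log_div (by positivity) hfpos.ne', Real.log_mul (by positivity) (by positivity),
    Real.log_mul hd.ne' (by positivity), Real.log_exp, Real.log_pow]
  have hlogf : -(n : ℝ) ≤ Real.log ‖classTwistedZeta₁ K (fun C ↦ (χ C : ℂ)) (2 + t * I)‖ := by
    rw [← Real.log_exp (-(n : ℝ))]
    exact Real.log_le_log hf0 hf
  unfold discBound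
  push_cast
  linarith

/-- `Z₁_χ` is analytic on every set (entire). [folklore] -/
theorem analyticOnNhd_classTwistedZeta₁ (a : ClassGroup (𝓞 K) → ℂ) (S : Set ℂ) :
    AnalyticOnNhd ℂ (classTwistedZeta₁ K a) S :=
  ((differentiable_classTwistedZeta₁ a).differentiableOn.analyticOnNhd isOpen_univ).mono
    (Set.subset_univ _)

/-- `Z₁_χ(2 + it) ≠ 0`. [folklore] -/
theorem classTwistedZeta₁_two_add_ne_zero (χ : ClassGroup (𝓞 K) →* ℂˣ) (t : ℝ) :
    classTwistedZeta₁ K (fun C ↦ (χ C : ℂ)) (2 + t * I) ≠ 0 := by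
  intro h
  have h1 := exp_neg_finrank_le_norm_classTwistedZeta₁_two_add χ t
  rw [h, norm_zero] at h1
  exact absurd h1 (not_le.mpr (Real.exp_pos _))

/-- **Zeros of `L(s, χ)` in a disc at height `t`, uniformly in `K`** (Jensen's inequality;
[ThornerZaman2019, Lemma 2.5] = [LO, Lemma 5.4] for the class group `L`-functions, conductor `1`,
in disc form): for `0 < r < 2`, the number of zeros of `Z₁_χ = (s − 1)L(s, χ)` in
`|s − (2 + it)| ≤ r`, counted with multiplicity (Mathlib's `divisor`), is at most `M_K(t)/log(2/r)`,
`M_K(t) = log|d_K| + 3n_K + (n_K + 1) log(|t| + 7)`. [cite: ThornerZaman2019, Lemma 2.5] -/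
theorem finsum_divisor_classTwistedZeta₁_le (χ : ClassGroup (𝓞 K) →* ℂˣ) (t : ℝ) {r : ℝ}
    (hr : 0 < r) (hr' : r < 2) :
    (∑ᶠ u, divisor (classTwistedZeta₁ K (fun C ↦ (χ C : ℂ))) (closedBall (2 + t * I) r) u : ℝ) ≤
      discBound K t / Real.log (2 / r) := by
  set f : ℂ → ℂ := classTwistedZeta₁ K (fun C ↦ (χ C : ℂ)) with hfdef
  set c : ℂ := 2 + t * I with hc
  set B : ℝ := ((discr K).natAbs : ℝ) * Real.exp (2 * Module.finrank ℚ K) *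
    (|t| + 7) ^ (Module.finrank ℚ K + 1) with hB
  have ha : ∀ C, ‖(fun C ↦ (χ C : ℂ)) C‖ ≤ 1 := fun C ↦ (norm_classGroupChar_apply χ C).le
  have hd1 : (1 : ℝ) ≤ ((discr K).natAbs : ℝ) := by exact_mod_cast Int.natAbs_pos.mpr (discr_ne_zero K)
  have hB1 : 1 ≤ B := by
    rw [hB]
    have h1 : (1 : ℝ) ≤ Real.exp (2 * Module.finrank ℚ K) := Real.one_le_exp (by positivity)
    have h2 : (1 : ℝ) ≤ (|t| + 7) ^ (Module.finrank ℚ K + 1) := one_le_pow₀ (by linarith [abs_nonneg t])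
    calc (1 : ℝ) = 1 * 1 * 1 := by ring
      _ ≤ _ := by gcongr
  have hc0 : f c ≠ 0 := classTwistedZeta₁_two_add_ne_zero χ t
  have h1 : 0 < |r| := by rwa [abs_of_pos hr]
  have h2 : |r| < |(2 : ℝ)| := by rw [abs_of_pos hr, abs_of_pos two_pos]; exact hr'
  have h3 : AnalyticOnNhd ℂ f (closedBall c |(2 : ℝ)|) := analyticOnNhd_classTwistedZeta₁ _ _
  have h4 : ∀ z ∈ sphere c |(2 : ℝ)|, ‖f z‖ ≤ B := by
    intro z hz
    rw [abs_of_pos two_pos] at hz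
    exact norm_classTwistedZeta₁_le_of_mem_closedBall ha t (sphere_subset_closedBall hz)
  have hJ := AnalyticOnNhd.sum_divisor_le h1 h2 hB1 h3 hc0 h4
  rw [abs_of_pos hr] at hJ
  have hcast : ((∑ᶠ u, divisor f (closedBall c r) u : ℤ) : ℝ) =
      ∑ᶠ u, (divisor f (closedBall c r) u : ℝ) :=
    map_finsum (Int.castRingHom ℝ) ((divisor f (closedBall c r)).finiteSupport (isCompact_closedBall _ _))
  rw [← hcast]
  refine hJ.trans (div_le_div_of_nonneg_right (log_discSup_div_norm_classTwistedZeta₁_le χ t)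
    (Real.log_nonneg ?_))
  rw [le_div_iff₀ hr]; linarith

/-- The Jensen count of the disc `|s − (2 + it)| ≤ 7/4`, as a sum over the support of the divisor:
`∑_ρ m(ρ) ≤ 8 M_K(t)` (`log(8/7) ≥ 1/8`). [cite: ThornerZaman2019, Lemma 2.5] -/
theorem sum_divisor_classTwistedZeta₁_le (χ : ClassGroup (𝓞 K) →* ℂˣ) (t : ℝ) :
    ∑ u ∈ ((divisor (classTwistedZeta₁ K (fun C ↦ (χ C : ℂ))) (closedBall (2 + t * I) (7 / 4))).finiteSupport
        (isCompact_closedBall _ _)).toFinset,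
      (divisor (classTwistedZeta₁ K (fun C ↦ (χ C : ℂ))) (closedBall (2 + t * I) (7 / 4)) u : ℝ) ≤
        8 * discBound K t := by
  set D := divisor (classTwistedZeta₁ K (fun C ↦ (χ C : ℂ))) (closedBall (2 + t * I) (7 / 4)) with hD
  have hfin : (Function.support D).Finite := D.finiteSupport (isCompact_closedBall _ _)
  have hsum : ∑ u ∈ hfin.toFinset, (D u : ℝ) = ∑ᶠ u, (D u : ℝ) := by
    rw [finsum_eq_sum_of_support_subset (fun u => (D u : ℝ)) (s := hfin.toFinset) ?_]
    intro u hu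
    simp only [Function.mem_support, ne_eq, Int.cast_eq_zero] at hu
    simpa using hu
  rw [hsum]
  have hJ := finsum_divisor_classTwistedZeta₁_le χ t (r := 7 / 4) (by norm_num) (by norm_num)
  refine hJ.trans ?_
  have hlog : 1 / 8 ≤ Real.log (2 / (7 / 4)) := by
    have := Real.one_sub_inv_le_log_of_pos (x := 2 / (7 / 4)) (by norm_num)
    norm_num at this ⊢
    linarith
  have hM := discBound_nonneg K t
  rw [div_le_iff₀ (by linarith)]
  nlinarith

/-! ### The local partial fraction (Lagarias–Odlyzko Lemma 5.6, disc form) -/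

/-- Jensen in the disc of radius `31/16`: at most `32 M_K(t)` zeros of `Z₁_χ`, with multiplicity
(`log(32/31) ≥ 1/32`). [cite: ThornerZaman2019, Lemma 2.5] -/
theorem sum_divisor_classTwistedZeta₁_bigDisc_le (χ : ClassGroup (𝓞 K) →* ℂˣ) (t : ℝ) :
    ∑ u ∈ ((divisor (classTwistedZeta₁ K (fun C ↦ (χ C : ℂ))) (closedBall (2 + t * I) (31 / 16))).finiteSupport
        (isCompact_closedBall _ _)).toFinset,
      (divisor (classTwistedZeta₁ K (fun C ↦ (χ C : ℂ))) (closedBall (2 + t * I) (31 / 16)) u : ℝ) ≤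
        32 * discBound K t := by
  set D := divisor (classTwistedZeta₁ K (fun C ↦ (χ C : ℂ))) (closedBall (2 + t * I) (31 / 16)) with hD
  have hfin : (Function.support D).Finite := D.finiteSupport (isCompact_closedBall _ _)
  have hsum : ∑ u ∈ hfin.toFinset, (D u : ℝ) = ∑ᶠ u, (D u : ℝ) := by
    rw [finsum_eq_sum_of_support_subset (fun u => (D u : ℝ)) (s := hfin.toFinset) ?_]
    intro u hu
    simp only [Function.mem_support, ne_eq, Int.cast_eq_zero] at hu
    simpa using hu
  rw [hsum]
  have hJ := finsum_divisor_classTwistedZeta₁_le χ t (r := 31 / 16) (by norm_num) (by norm_num)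
  refine hJ.trans ?_
  have hlog : 1 / 32 ≤ Real.log (2 / (31 / 16)) := by
    have := Real.one_sub_inv_le_log_of_pos (x := 2 / (31 / 16)) (by norm_num)
    norm_num at this ⊢
    linarith
  have hM := discBound_nonneg K t
  rw [div_le_iff₀ (by linarith)]
  nlinarith

/-- **The local partial fraction of `Z₁_χ'/Z₁_χ`, uniformly in `K` and `χ`** ([LO, Lemma 5.6] /
[ThornerZaman2019, §2.3], disc form, for `Z₁_χ = (s − 1) L(s, χ)`, whose logarithmic derivative is
`L'/L(s, χ) + 1/(s − 1)`): for real `t` and `|s − (2 + it)| ≤ 7/4` with `Z₁_χ(s) ≠ 0`,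
`|Z₁_χ'/Z₁_χ(s) − Σ_ρ m(ρ)/(s − ρ)| ≤ 77760 · M_K(t)`, the sum over the zeros `ρ` of `Z₁_χ` in
`|ρ − (2 + it)| ≤ 31/16` with multiplicities (Landau's lemma, the tree's
`Literature.Analysis.Complex.norm_logDeriv_sub_sum_le`, radii `7/4 < 15/8 < 31/16 < 2`).
[cite: LagariasOdlyzko1977, Lemma 5.6] -/
theorem norm_logDeriv_classTwistedZeta₁_sub_sum_le (χ : ClassGroup (𝓞 K) →* ℂˣ) (t : ℝ) {s : ℂ}
    (hs : s ∈ closedBall (2 + t * I) (7 / 4)) (hfs : classTwistedZeta₁ K (fun C ↦ (χ C : ℂ)) s ≠ 0) :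
    ‖logDeriv (classTwistedZeta₁ K (fun C ↦ (χ C : ℂ))) s -
        ∑ u ∈ ((divisor (classTwistedZeta₁ K (fun C ↦ (χ C : ℂ))) (closedBall (2 + t * I) (31 / 16))).finiteSupport
            (isCompact_closedBall _ _)).toFinset,
          (divisor (classTwistedZeta₁ K (fun C ↦ (χ C : ℂ))) (closedBall (2 + t * I) (31 / 16)) u : ℂ) /
            (s - u)‖ ≤
      77760 * discBound K t := by
  classical
  set f := classTwistedZeta₁ K (fun C ↦ (χ C : ℂ)) with hf
  set c : ℂ := 2 + t * I with hc
  set B : ℝ := ((discr K).natAbs : ℝ) * Real.exp (2 * Module.finrank ℚ K) *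
    (|t| + 7) ^ (Module.finrank ℚ K + 1) with hB
  set M : ℝ := discBound K t with hM
  have ha : ∀ C, ‖(fun C ↦ (χ C : ℂ)) C‖ ≤ 1 := fun C ↦ (norm_classGroupChar_apply χ C).le
  have hM1 : 1 ≤ M := one_le_discBound K t
  have hc0 : f c ≠ 0 := classTwistedZeta₁_two_add_ne_zero χ t
  have h := Literature.Analysis.Complex.norm_logDeriv_sub_sum_le (f := f) (c := c)
    (r := 7 / 4) (r₁ := 15 / 8) (R₂ := 31 / 16) (R := 2) (B := B)
    (by norm_num) (by norm_num) (by norm_num) (by norm_num)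
    (analyticOnNhd_classTwistedZeta₁ _ _) hc0
    (fun z hz ↦ norm_classTwistedZeta₁_le_of_mem_closedBall ha t hz) hs hfs
  set D := divisor f (closedBall c (31 / 16)) with hD
  set S := (D.finiteSupport (isCompact_closedBall c (31 / 16))).toFinset with hS
  set N : ℝ := ∑ u ∈ S, (D u : ℝ) with hN
  have hN32 : N ≤ 32 * M := sum_divisor_classTwistedZeta₁_bigDisc_le χ t
  have hlog32 : Real.log (2 / (2 - 31 / 16)) ≤ 5 := by
    rw [show (2 : ℝ) / (2 - 31 / 16) = 32 by norm_num]
    exact log_thirtyTwo_le_five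
  have hlogB : Real.log (B / ‖f c‖) ≤ M := log_discSup_div_norm_classTwistedZeta₁_le χ t
  have hD0 : ∀ u, 0 ≤ D u := fun u ↦
    (analyticOnNhd_classTwistedZeta₁ (K := K) (fun C ↦ (χ C : ℂ)) (closedBall c (31 / 16))).divisor_nonneg u
  have hN0 : 0 ≤ N := Finset.sum_nonneg fun u _ ↦ by exact_mod_cast hD0 u
  refine h.trans ?_
  have hK : 2 * (15 / 8 : ℝ) / ((31 / 16 - 15 / 8) * (15 / 8 - 7 / 4)) = 480 := by norm_num
  rw [hK]
  have h1 : N * Real.log (2 / (2 - 31 / 16)) ≤ 32 * M * 5 :=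
    mul_le_mul hN32 hlog32 (Real.log_nonneg (by norm_num)) (by positivity)
  nlinarith

end Literature.NumberTheory.LFunctions.NumberField

end
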